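import Summits.AnomalousDissipation.AnomalousDissipation.Theses.ImpulseGrid
import Summits.AnomalousDissipation.AnomalousDissipation.Theorems.ImpulseGridGridThesisStubLaplacianPairingBound
import Summits.AnomalousDissipation.AnomalousDissipation.Theorems.ImpulseGridGridThesisStubWorkSplitTransfer
import Summits.AnomalousDissipation.AnomalousDissipation.Theorems.ImpulseGridGridThesisStubAlphaBalance
import Summits.AnomalousDissipation.AnomalousDissipation.Theorems.ImpulseGridGridThesisStubAcWorkOfQuadratureDrag
import Summits.AnomalousDissipation.AnomalousDissipation.Theorems.ImpulseGridGridThesisStubDcWorkOfDrag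
import Summits.AnomalousDissipation.AnomalousDissipation.Theorems.ImpulseGridGridThesisStubNoReversalNoPressure
import Summits.AnomalousDissipation.AnomalousDissipation.Theorems.ImpulseGridGridThesisStubAcdcDesignCalculus
import Summits.AnomalousDissipation.AnomalousDissipation.Theorems.ImpulseGridGridThesisStubAcdcDesignIntegrals
import Summits.AnomalousDissipation.AnomalousDissipation.Theorems.ImpulseGridGridThesisStubAcdcStrainBound
import Literature.Analysis.FluidPDE.LerayHopfUniformEnergyMomentum
import Literature.Analysis.FluidPDE.TimeAverageMeasureExistence

/-!
# Skeleton — crux `ImpulseGrid.GridThesis` (stmt-AnomalousDissipation-1770), line `Sketch` (cycle 3)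

Line lead `prover-line-stmt-AnomalousDissipation-1770-0`, 2026-08-16. Reshaped from the checked
skeleton `Cruxes/GridThesis/SketchIdeator2.lean` (crux-ideate round 1, ideator 2: cards
`ac-dc-eddy-drag` + `no-reversal-half-space`).

## History
* cycle 1: W1–W6 LANDED — Theorems/ImpulseGridGridThesisStub{LaplacianPairingBound p103141,
  WorkSplitTransfer p103195, AlphaBalance p103160, AcWorkOfQuadratureDrag p102597, DcWorkOfDrag
  p102496, NoReversalOfSubthresholdWake p103818}.
* cycle 2: lead stub reshaped into the EXPLICIT AC/DC design; W6′ NoReversalNoPressure p106774,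
  W7 AcdcDesignCalculus p106706, W8 AcdcDesignIntegrals p106585 LANDED.
* cycle 3 (this file): the per-`j` sup-energy clause is DERIVED (Leray–Hopf with a mean-zero
  steady force at ν > 0: `IsGlobalLerayHopf.exists_forall_integral_norm_sq_le_of_hasZeroMean`,
  Literature/LerayHopfUniformEnergyMomentum) and the strain constant is made EXPLICIT,
  `σ = 4πmA` (`stub_acdcStrainBound`, W9: for the cellular pattern `⟪ξ,(ξ·∇)G⟫ = α(ξ₁²−ξ₂²)`,
  `α = 4πmA cos 2πmx₁ cos 2πmx₂`; LANDED p108132), so the lead stub `stub_dragFamilyForAcdcGrid` carries no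
  auxiliary quantifier: it is the bare open content of the line.

## Composition (`GridThesis_of`, proved below modulo the `stub_*` theorems)
crux ⇐ `stub_workSplitTransfer` ⇐ `stub_laplacianPairingBound` ⇐ AC work (`stub_alphaBalance`,
`stub_acWorkOfQuadratureDrag`) ⇐ DC work per `j` (`stub_dcWorkOfDrag` or
`stub_noReversalOfSubthresholdWakeNoPressure`) ⇐ design facts (`stub_acdcDesignCalculus`,
`stub_acdcDesignIntegrals`, `stub_acdcStrainBound`) ⇐ lead stub `stub_dragFamilyForAcdcGrid`.
All ten worker stubs are landed and imported; exactly ONE `sorry` remains — the lead stub.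
-/

noncomputable section

-- `Summit.<Summit>.<Problem>` is the tree's mandated summit-side namespace (CONVENTIONS §2); for this
-- single-conjunct summit the two coincide, so the duplicate is deliberate.
set_option linter.dupNamespace false

open MeasureTheory Set Filter Topology
open scoped InnerProductSpace RealInnerProductSpace

namespace Summit.AnomalousDissipation.AnomalousDissipation.Cruxes.GridThesis.Sketch

open Summit.AnomalousDissipation.AnomalousDissipation.Theses.ImpulseGrid
open Summit.AnomalousDissipation.AnomalousDissipation.Theorems
open Literature.Analysis.FluidPDE Literature.Analysis.FluidPDE.Torus
open Literature.Analysis.FunctionSpaces Literature.Analysis.FunctionSpaces.Torus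

/-! ### Worker stubs: ALL LANDED (cycles 1–3) and imported from the tree
W1 `stub_laplacianPairingBound` p103141 · W2 `stub_workSplitTransfer` p103195 · W3 `stub_alphaBalance`
p103160 · W4 `stub_acWorkOfQuadratureDrag` p102597 · W5 `stub_dcWorkOfDrag` p102496 · W6
`stub_noReversalOfSubthresholdWake` p103818 · W6′ `stub_noReversalOfSubthresholdWakeNoPressure` p106774
· W7 `stub_acdcDesignCalculus` p106706 · W8 `stub_acdcDesignIntegrals` p106585 · W9
`stub_acdcStrainBound` p108132 (files `Theorems/ImpulseGridGridThesisStub*.lean`). -/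

/-! ### Stub (LEAD) — the drag family of the explicit AC/DC grid (conjecture-grade) -/

/-- **Stub (LEAD, hardest; the open content of the line).** At SOME mesh `m ≥ 1`, pattern
amplitude `A > 0`, modulation depth `θ > 0` and drift `c > 0`, the explicit AC/DC grid force
`Φ•G` (`Φ = 1 + 2θ cos 2πx₀`; `G` the cellular two-mode Stokes pattern of W7–W9; `C = cos(2πx₀)G`,
`S = sin(2πx₀)G` its swept quadrature pair) admits a vanishing-viscosity family of global
Leray–Hopf solutions with drift data `∫u₀ⱼ = c e₀`, ν-uniformly bounded mean energy and no
Leray–Hopf leakage, a margin `δ > 0` and one Banach mean `Λ`, such that the wake exerts AC EDDY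
DRAG on the swept pair, `Λ⟨X·T_C + Y·T_S⟩ ≤ −δ` (`X = (C,uⱼ)`, `Y = (S,uⱼ)`,
`T_P(u) = ∫⟪u,(u·∇)P⟫`), and for each `j` either DC EDDY DRAG `Λ⟨a·T_G⟩ ≤ 0` (`a = (G,uⱼ)`) or a
SUB-THRESHOLD WAKE at the zero set of the imprint: `(G,u₀ⱼ) ≥ 0` and
`4πmA·(2KE(uⱼ(t)) − c²) ≤ (Φ•G, G) (= ‖G‖₂² = 2A²)` whenever `(G,uⱼ(t)) ≤ 0`, `t > 0`.
Intended regime (cards): fine mesh and Taylor's frozen-flow corner `1/m ≲ A/c² ≪ 1`.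
Why it might fail: it contains a steady-force zeroth-law witness (bounded energy + no-leak + a
ν-uniform positive AC absorption `2θΛ⟨X⟩ ≥ 2δ/‖G‖²`); AC drag fails for a pumped (phase-locked,
recoiling) swept oscillator, DC drag for negative eddy viscosity at the forcing scale; the
sub-threshold alternative fails for energetic reversals (2-D-isation: 2-D wakes do not decay).
No laminar (swept/x₀-independent) family can witness it: there the AC work is `O(ν)`. -/
theorem stub_dragFamilyForAcdcGrid :
    ∃ (m : ℕ) (A θ c δ : ℝ) (Λ : GeneralizedLimit) (Φ Ψ : UnitAddTorus (Fin 3) → ℝ) (G C S : UnitAddTorus (Fin 3) → EuclideanSpace ℝ (Fin 3))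
      (ν : ℕ → ℝ) (u₀ : ℕ → UnitAddTorus (Fin 3) → EuclideanSpace ℝ (Fin 3)) (u : ℕ → ℝ → UnitAddTorus (Fin 3) → EuclideanSpace ℝ (Fin 3)),
      Φ = (fun x => 1 + 2 * θ * (UnitAddTorus.mFourier (Pi.single (0 : Fin 3) (1 : ℤ)) x).re) ∧
      Ψ = (fun x => θ / Real.pi * (UnitAddTorus.mFourier (Pi.single (0 : Fin 3) (1 : ℤ)) x).im) ∧
      G = (fun x => A • (stokesMode ![(0 : ℤ), (m : ℤ), (m : ℤ)] (EuclideanSpace.single (1 : Fin 3) (1 : ℝ) - EuclideanSpace.single (2 : Fin 3) (1 : ℝ)) false x +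
          stokesMode ![(0 : ℤ), (m : ℤ), -(m : ℤ)] (EuclideanSpace.single (1 : Fin 3) (1 : ℝ) + EuclideanSpace.single (2 : Fin 3) (1 : ℝ)) false x)) ∧
      C = (fun x => (UnitAddTorus.mFourier (Pi.single (0 : Fin 3) (1 : ℤ)) x).re • G x) ∧ S = (fun x => (UnitAddTorus.mFourier (Pi.single (0 : Fin 3) (1 : ℤ)) x).im • G x) ∧
      1 ≤ m ∧ 0 < A ∧ 0 < θ ∧
      0 < c ∧ 0 < δ ∧
      (∀ j, 0 < ν j) ∧ Tendsto ν atTop (nhds 0) ∧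
      (∀ j, IsGlobalLerayHopf (ν j) (fun _ => fun x => Φ x • G x) (u₀ j) (u j)) ∧
      (∀ j, ∫ x, u₀ j x = c • EuclideanSpace.single 0 1) ∧
      (∃ E : ℝ, ∀ j, meanEnergy (u j) ≤ E) ∧
      (∀ j, longTimeAvgSup (fun t => ∫ x, ⟪Φ x • G x, u j t x⟫) ≤ meanDissipation (ν j) (u j)) ∧
      (∀ j, Λ.longTimeAvg (fun t =>
        (∫ x, ⟪C x, u j t x⟫) * (∫ x, ⟪u j t x, convect (u j t) C x⟫) +
          (∫ x, ⟪S x, u j t x⟫) * (∫ x, ⟪u j t x, convect (u j t) S x⟫)) ≤ -δ) ∧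
      (∀ j, Λ.longTimeAvg (fun t => (∫ x, ⟪G x, u j t x⟫) * ∫ x, ⟪u j t x, convect (u j t) G x⟫) ≤ 0 ∨
        ((0 ≤ ∫ x, ⟪G x, u₀ j x⟫) ∧ ∀ t : ℝ, 0 < t → (∫ x, ⟪G x, u j t x⟫) ≤ 0 →
          (4 * Real.pi * (m : ℝ) * A) * (2 * kineticEnergy (u j t) - c ^ 2) ≤ ∫ x, ⟪Φ x • G x, G x⟫)) := by
  sorry

/-! ### The composition -/

/-- A function non-negative on `(0, ∞)` and bounded there has non-negative generalized long-time
average (the value at `t ≤ 0` is irrelevant to the Cesàro means). -/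
theorem longTimeAvg_nonneg_of_pos (Λ : GeneralizedLimit) {g : ℝ → ℝ} {K : ℝ}
    (h0 : ∀ t, 0 < t → 0 ≤ g t) (hK : ∀ t, 0 < t → |g t| ≤ K) : 0 ≤ Λ.longTimeAvg g := by
  rw [Λ.longTimeAvg_congr (h := fun t => if 0 < t then g t else 0) (fun t ht => by simp [ht])]
  refine Λ.longTimeAvg_nonneg (C := |K|) (fun t => ?_) (fun t ht => ?_)
  · by_cases h : 0 < t
    · simp only [h, if_true]; exact h0 t h
    · simp [h]
  · simp only [ht, if_true]
    exact (hK t ht).trans (le_abs_self K)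

/-- **The line closes the crux modulo its stubs**: the lead stub `stub_dragFamilyForAcdcGrid` and
W9 (plus the landed W1–W8, W6′) imply `GridThesis` BY NAME. Per-`j` sup-energy bounds from the
Leray–Hopf class (mean-zero steady force, ν > 0); AC work
`Λ⟨((Φ−1)G,uⱼ)⟩ = 2θΛ⟨Xⱼ⟩ ≥ 2θδ/(θ‖G‖²)`; DC work `≥ 0` by eddy drag or by the barrier; then the
work-split transfer. -/
theorem GridThesis_of : GridThesis := by
  obtain ⟨m, A, θ, c, δ, Λ, Φ, Ψ, G, C, S, ν, u₀, u, hΦd, hΨd, hGd, hCd, hSd, hm, hA, hθ, hc,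
    hδ, hν, hν0, hLH, hdrift, hE, hNL, hACdrag, hDC⟩ := stub_dragFamilyForAcdcGrid
  obtain ⟨hΦ, hΨ, hG, hΨinv, hGinv, hG0, hGdiv, hΨ', hfs, hfdiv, hΔG, hCs, hSs, hCdiv, hSdiv, hΔC,
    hΔS, hAC⟩ := stub_acdcDesignCalculus m A θ Φ Ψ G C S hΦd hΨd hGd hCd hSd hm hA hθ
  obtain ⟨hΦΨG, hfmean, hfC, hfS, hfG, hGpos⟩ :=
    stub_acdcDesignIntegrals m A θ Φ Ψ G C S hΦd hΨd hGd hCd hSd hm hA hθ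
  have hstrain := stub_acdcStrainBound m A G hGd hA
  have hσ : 0 ≤ (4 * Real.pi * (m : ℝ) * A) := by positivity
  have hlam : 0 < (8 * Real.pi ^ 2 * (m : ℝ) ^ 2) := by
    have : (1 : ℝ) ≤ (m : ℝ) := by exact_mod_cast hm
    positivity
  have hμ : 0 < (4 * Real.pi ^ 2 * (2 * (m : ℝ) ^ 2 + 1)) := by positivity
  -- per-j sup-in-time kinetic-energy bounds (Leray–Hopf, mean-zero steady force, ν > 0)
  have hsup : ∀ j, ∃ C₀ : ℝ, ∀ t : ℝ, 0 ≤ t → kineticEnergy (u j t) ≤ C₀ := by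
    intro j
    obtain ⟨R, hR⟩ := (hLH j).exists_forall_integral_norm_sq_le_of_hasZeroMean (hν j) (hfs.memLp 2)
      hfmean
    refine ⟨2⁻¹ * R, fun t ht => ?_⟩
    unfold kineticEnergy
    exact mul_le_mul_of_nonneg_left (hR t ht) (by norm_num)
  -- AC work from AC eddy drag
  have hκ : 0 < θ * ∫ x, ‖G x‖ ^ 2 := mul_pos hθ hGpos
  have hX : ∀ j, δ / (θ * ∫ x, ‖G x‖ ^ 2) ≤ Λ.longTimeAvg (fun t => ∫ x, ⟪C x, u j t x⟫) :=
    fun j => stub_acWorkOfQuadratureDrag Λ (ν j) (4 * Real.pi ^ 2 * (2 * (m : ℝ) ^ 2 + 1)) (θ * ∫ x, ‖G x‖ ^ 2) δ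
      (fun x => Φ x • G x) C S (u₀ j) (u j) stub_alphaBalance hfs hCs hSs hCdiv hSdiv hΔC hΔS
      (mul_pos (hν j) hμ).le hfC hκ hfS (hLH j) (hsup j) (hACdrag j)
  have hACwork : ∀ j, Λ.longTimeAvg (fun t => ∫ x, ⟪(Φ x - 1) • G x, u j t x⟫) =
      (2 * θ) * Λ.longTimeAvg (fun t => ∫ x, ⟪C x, u j t x⟫) := by
    intro j
    rw [← Λ.longTimeAvg_const_mul]
    congr 1
    funext t
    rw [← integral_const_mul]
    refine integral_congr_ae (ae_of_all _ fun x => ?_)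
    show ⟪(Φ x - 1) • G x, u j t x⟫ = 2 * θ * ⟪C x, u j t x⟫
    rw [hAC x, real_inner_smul_left]
  have hη : 0 < 2 * θ * (δ / (θ * ∫ x, ‖G x‖ ^ 2)) := by positivity
  have hACge : ∀ j, 2 * θ * (δ / (θ * ∫ x, ‖G x‖ ^ 2)) ≤
      Λ.longTimeAvg (fun t => ∫ x, ⟪(Φ x - 1) • G x, u j t x⟫) := by
    intro j
    rw [hACwork j]
    exact mul_le_mul_of_nonneg_left (hX j) (by positivity)
  -- DC work, by eddy drag or by the sub-threshold barrier
  have hfGpos : 0 < ∫ x, ⟪Φ x • G x, G x⟫ := by rw [hfG]; exact hGpos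
  have hDCge : ∀ j, 0 ≤ Λ.longTimeAvg (fun t => ∫ x, ⟪G x, u j t x⟫) := by
    intro j
    rcases hDC j with hdrag | ⟨hal, hthr⟩
    · exact stub_dcWorkOfDrag Λ (ν j) (8 * Real.pi ^ 2 * (m : ℝ) ^ 2) (fun x => Φ x • G x) G (u₀ j) (u j)
        stub_alphaBalance hfs hG hGdiv hΔG (mul_pos (hν j) hlam).le hfGpos (hLH j) (hsup j) hdrag
    · have hpt := stub_noReversalOfSubthresholdWakeNoPressure (ν j) (8 * Real.pi ^ 2 * (m : ℝ) ^ 2) (4 * Real.pi * (m : ℝ) * A) c Φ G (u₀ j)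
        (u j) (mul_pos (hν j) hlam).le hσ hG hGinv hG0 hGdiv hΔG hstrain hfs hfmean (hLH j)
        (hsup j) (hdrift j) hal hthr
      obtain ⟨K, hK0, hK⟩ := exists_nonneg_forall_norm_le_of_continuous hG.continuous
      obtain ⟨C₀, hC₀⟩ := hsup j
      refine longTimeAvg_nonneg_of_pos Λ (K := K * (2⁻¹ * (1 + 2 * C₀))) hpt (fun t ht => ?_)
      have h := impulseGrid_abs_integral_inner_le (Φ₀ := G) (hLH j) hK0 hK hC₀ ht.le
      have hcomm : (∫ x, ⟪G x, u j t x⟫) = ∫ x, ⟪u j t x, G x⟫ :=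
        integral_congr_ae (ae_of_all _ fun x => real_inner_comm _ _)
      rw [hcomm]
      exact h
  -- the linear form C⁺, then the transfer
  exact stub_workSplitTransfer stub_laplacianPairingBound
    ⟨Φ, Ψ, G, c, 2 * θ * (δ / (θ * ∫ x, ‖G x‖ ^ 2)), Λ, hΦ, hΨ, hG, hΨinv, hGinv, hG0, hGdiv, hΨ',
      hΦΨG, hfs, hfdiv, hfmean, hc, hη, ν, u₀, u, hν, hν0, hLH, hsup, hdrift, hE, hNL, hDCge, hACge⟩

end Summit.AnomalousDissipation.AnomalousDissipation.Cruxes.GridThesis.Sketch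

end
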